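import Summits.QuantumFields.YangMills.Theorems.BalabanUVNodesN21ShellSplitOfRecord13CoPHLaw
import Summits.QuantumFields.YangMills.Theorems.BalabanUVNodesN21CollarJunctionProjectedCentre

/-!
# N21 (NE7c) · THE COLLAR JUNCTION AT THE RECORD's CUBE LAWS: the collar ENDs 38m ∕ 38n, read THROUGH A BLOCK CHART,
# discharge the per-top-cube (M1) of dag-n21-d's shell split of record on `cubeLawOfDatum₉ … t a`

R141 (C) seat pub-ymgap-dag-n21-e (g19), node N21 = NE7c (single-run shell-weight bound, NOT PRINTED in [Bałaban
1983–89], NOT proved), strategy s3 ALTERNATIVE CURRENCY, lane K3⁷ `SpineGivenEndpointR13SepCoPH`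
(stmt-QuantumFields-20544, `--kind proof --supports … --as helper`).  Part 38s of this seat's series; consumes BY NAME
dag-n21-d g9's shell split OF RECORD (`…N21ShellSplitOfRecord13CoPHLaw` ★★★ `cubeAC_of_slotAntiConcentration`) and
this seat's collar ENDs 38m (`…N21CollarJunctionLowCentre` ★★★) ∕ 38n (`…N21CollarJunctionProjectedCentre` ★★★).

WHY.  dag-n21-d's split of record reduces N21 AT THE RECORD, per (run, K, t, top cube a), to ONE displayed estimate:
`T4ShellMeasure.SlotAntiConcentration (cubeLawOfDatum₉ … t a) u ε_k ρ D` for any statistic `u` reading cube `a`'s two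
(2.17) tests — (M1) on ONE DEFINITE MEASURE, the record's `a`-truncated dressed law on the level-`k` gauge fields.  The
collar ENDs conclude EXACTLY this shape, but on a block frame `X × (κ → ℝ)` (exterior variables × the block's real
coordinates) for a frame law `((ζ.prod volume).withDensity 𝟙_K·e^{−φ})|({U<θ} ∩ C)`.  The junction is a BLOCK CHART
`Φ : GaugeField → Y` with `u = U ∘ Φ`: (M1) pulls back along any measurable chart from the IMAGE LAW
(`T4ShellMeasureFibre.slotAntiConcentration_comap`), and — without any measurability — from any frame law that
DOMINATES the image law on the shell (ratio `M₁`) and is dominated by it in total mass (ratio `M₂`): the (2.18) fibre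
law in block coordinates vs. the collar's convex model density, e.g. `M₁ = M₂ = e^{η}` for a perturbation of the
exponent bounded by `η` on the cut.  So:
* §1 [dict ∕ transport, generic] `slotAntiConcentration_of_chartLaw` (`μ.map Φ = ν'` ⇒ (M1) for `ν', U` gives (M1) for
  `μ, U ∘ Φ`, same constant) · `slotAntiConcentration_of_chartLaw_dominated` (dict as TWO inequalities ⇒ constant
  `D·(M₁·M₂)`; no measurability needed);
* §2 AT THE CUBE LAW: ★ `cubeAC_of_chart` (dag-n21-d's ★★★ with the (M1) binder MOVED to the image law
  `(cubeLawOfDatum₉ … t a).map Φ`) · ★★ `cubeAC_of_chart_dominated` (the (M1) binder on ANY frame law `ν'` comparable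
  to the cube law through the chart) · ★★′ `cubeAC_of_chart_comparableDensity` (the dictionary as NODE O would meet
  it: an exact disintegration `(cubeLawOfDatum₉ … t a).map Φ = (base.withDensity d₁)|E` and a model density `d₀`
  two-sided comparable to `d₁` on `E`; §1 `withDensity_restrict_le_of_le`) · ★★★ `cubeAC_of_lowCentre_collar_chart`
  (38m ★★★'s binders on the frame + chart + domination dict ⇒
  `Σ_s shellPiece … ρ t a s ≤ ((3(#κ+1)∏ᵢ(1+Qᵢ)∕(κ₀(1−ρ)))·(M₁·M₂)·ρ)·Σ_s cubeWeight … t a s`, the `hM1` of dag-n21-d's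
  FILES 2∕3 AT cube `a`) · ★★★ `cubeAC_of_projectedCentre_collar_chart` (38n);
* sibling file 38s′ `…N21CollarJunctionAtCubeLawKeyed` (400-line rule) ★★
  `shellWeightBound_crOfRecord₁₃At_shellSplit_of_charts`: dag-n21-d's ★★★ at `crOfRecord₁₃At K₀ jcut
  (shellSplitOfRecord₁₃At N K₀ ρA ρB)` with `hM1A ∕ hM1B` DISCHARGED by ★ here from per-(run, K, t, a) charts into one
  block frame `Y` and (M1) on the IMAGE LAWS — N21 at the record = (M1) in block coordinates, `Σ_K D_K ρ_K < ∞`.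

BINDERS LEFT (displayed; other lanes' objects, none asserted): the charts `Φ` and their dictionary (image law = ∕ ≍
frame law: the (2.18) fibre law in block coordinates — NODE O's term object; the Haar Jacobian is dag-n21-d part 24),
the reading clauses `hu ∕ hu'` (`U ∘ Φ` reads cube `a`'s two tests), 38m ∕ 38n's per-slot binders exactly as in 38r
(centre inequality `hlow` ∕ `hobt`+`hfar`, radial transversality `hRT`, letters, core, species odds `hodds`), (H-U),
`0 ≤ w` ∕ `0 ≤ ζ`, F3's (e1) integrability, level letters.  A6 (director-ym STANDING RULE №189 (3)) said plainly:
§1 is [textbook] transport whose binders are a chart and two inequalities; §2's cube-law binders live on NODE 00's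
`T4Family ∕ Stage9Params ∕ FiniteEpsData` objects and are NOT inhabited here (the zero width `ρ = 0` is the junk
instance, as in dag-n21-d's FILE 3); the collar frame's binders are inhabited in 38m′ ∕ 38r′ (p590169).

HONEST FRAMING.  [textbook] by-name composition (`Measure.map`, pull-back ∕ domination of (M1)); 0 def, 0 sorry;
nothing of Bałaban's asserted ([Balaban1989LargeFieldI] p. 176 ∕ p. 193 = the located MECHANISM only); (M1) NOT PRINTED
∕ NOT proved; NE7c NOT proved; N21 NOT discharged; K3⁷ NOT claimed; counts unmoved (typed 28∕28 · discharged 5∕27);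
count-neutral; one finite 𝕋⁴ at fixed ε — nothing about ℝ⁴ ∕ OS ∕ mass gap ∕ Clay.
-/

set_option autoImplicit false

open MeasureTheory Set Function Matrix
open scoped ENNReal BigOperators

namespace Summit.QuantumFields.YangMills.Theorems.N21CollarJunctionAtCubeLaw

open Literature.MathematicalPhysics.QuantumFieldTheory.Balaban1983to89
open Literature.MathematicalPhysics.QuantumFieldTheory.Balaban1983to89.T4Continuum
open Literature.MathematicalPhysics.QuantumFieldTheory.Balaban1983to89.Node00
open Literature.MathematicalPhysics.QuantumFieldTheory.Balaban1983to89.T4ShellMeasure (SlotAntiConcentration)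
open Literature.MathematicalPhysics.QuantumFieldTheory.Balaban1983to89.T4ShellMeasureFibre
  (slotAntiConcentration_comap)
open Summit.QuantumFields.YangMills.Theorems.N21ShellSplitOfRecord13CoPH
open Summit.QuantumFields.YangMills.Theorems.N21CollarJunctionLowCentre
  (slotAntiConcentration_restrict_of_lowCentre_letterwise)
open Summit.QuantumFields.YangMills.Theorems.N21CollarJunctionProjectedCentre
  (slotAntiConcentration_restrict_of_projectedCentre_letterwise)

/-! ## §1 (M1) through a block chart: from the image law, or from a comparable frame law -/

section Chart

variable {Ω Y : Type*} [MeasurableSpace Ω] [MeasurableSpace Y]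

/-- **[dict ∕ transport] (M1) FROM THE IMAGE LAW OF A BLOCK CHART.**  If `Φ : Ω → Y` is measurable, the image law of `μ`
IS the frame law `ν'` (`μ.map Φ = ν'`), and `ν'` satisfies (M1) for the statistic `U`, then `μ` satisfies (M1) for
`U ∘ Φ` with the same constant (`T4ShellMeasureFibre.slotAntiConcentration_comap` BY NAME). [textbook] -/
theorem slotAntiConcentration_of_chartLaw {μ : Measure Ω} {Φ : Ω → Y} (hΦ : Measurable Φ) {ν' : Measure Y}
    (hdict : μ.map Φ = ν') {U : Y → ℝ} {θ ρ D : ℝ} (h : SlotAntiConcentration ν' U θ ρ D) :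
    SlotAntiConcentration μ (U ∘ Φ) θ ρ D := by
  subst hdict
  exact slotAntiConcentration_comap hΦ h

/-- **[dict ∕ transport] (M1) FROM A TWO-SIDED COMPARABLE FRAME LAW** (no measurability needed).  If the shell mass of
`U ∘ Φ` under `μ` is at most `M₁` times the shell mass of `U` under a frame law `ν'`, `ν'` satisfies (M1) for `U` with
constant `D ≥ 0`, and `ν'`'s total mass is at most `M₂` times `μ`'s, then `μ` satisfies (M1) for `U ∘ Φ` with constant
`D·(M₁·M₂)` (`ρ, M₁ ≥ 0`) — e.g. the image law and the frame law have densities `e^{−(φ+r)}` ∕ `e^{−φ}` against one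
base with `|r| ≤ η` on the cut: `M₁ = M₂ = e^{η}` (bounded perturbation of the convex model). [textbook] -/
theorem slotAntiConcentration_of_chartLaw_dominated {μ : Measure Ω} (Φ : Ω → Y) {ν' : Measure Y} {U : Y → ℝ}
    {θ ρ D M₁ M₂ : ℝ} (hD : 0 ≤ D) (hρ : 0 ≤ ρ) (hM₁ : 0 ≤ M₁)
    (hS : μ {x | θ * (1 - ρ) ≤ U (Φ x) ∧ U (Φ x) < θ} ≤
      ENNReal.ofReal M₁ * ν' {y | θ * (1 - ρ) ≤ U y ∧ U y < θ})
    (h : SlotAntiConcentration ν' U θ ρ D) (hmass : ν' univ ≤ ENNReal.ofReal M₂ * μ univ) :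
    SlotAntiConcentration μ (U ∘ Φ) θ ρ (D * (M₁ * M₂)) := by
  unfold SlotAntiConcentration at h ⊢
  calc μ {x | θ * (1 - ρ) ≤ (U ∘ Φ) x ∧ (U ∘ Φ) x < θ}
      ≤ ENNReal.ofReal M₁ * ν' {y | θ * (1 - ρ) ≤ U y ∧ U y < θ} := hS
    _ ≤ ENNReal.ofReal M₁ * (ENNReal.ofReal (D * ρ) * ν' univ) := by gcongr
    _ ≤ ENNReal.ofReal M₁ * (ENNReal.ofReal (D * ρ) * (ENNReal.ofReal M₂ * μ univ)) := by gcongr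
    _ = ENNReal.ofReal (D * (M₁ * M₂) * ρ) * μ univ := by
        rw [← mul_assoc, ← mul_assoc, ← ENNReal.ofReal_mul hM₁, ← ENNReal.ofReal_mul (by positivity)]
        congr 2; ring

/-- **[dict] COMPARABLE DENSITIES GIVE THE DOMINATION INEQUALITIES.**  On a kept event `E`, if `d₁ ≤ M·d₀` pointwise
then `(base.withDensity d₁)|E S ≤ M·(base.withDensity d₀)|E S` for measurable `E`, `S` — e.g. `d₁ = 𝟙_K·e^{−(φ+r)}`
(the fibre law's density in the chart) and `d₀ = 𝟙_K·e^{−φ}` (the convex model) with `|r| ≤ η` on `E`: `M = e^{η}`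
both ways. [textbook] -/
theorem withDensity_restrict_le_of_le {base : Measure Y} {d₁ d₀ : Y → ℝ≥0∞} {E S : Set Y} (hE : MeasurableSet E)
    (hS : MeasurableSet S) {M : ℝ} (hd : ∀ y ∈ E, d₁ y ≤ ENNReal.ofReal M * d₀ y) :
    (base.withDensity d₁).restrict E S ≤ ENNReal.ofReal M * (base.withDensity d₀).restrict E S := by
  rw [Measure.restrict_apply hS, Measure.restrict_apply hS, withDensity_apply _ (hS.inter hE),
    withDensity_apply _ (hS.inter hE), ← lintegral_const_mul' _ _ ENNReal.ofReal_ne_top]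
  exact setLIntegral_mono' (hS.inter hE) fun y hy => hd y hy.2

end Chart

/-! ## §2 At the record's `a`-truncated dressed law `cubeLawOfDatum₉ … t a` -/

section AtCubeLaw

variable (F : T4Family) (N : ℕ) [NeZero N] (ϑ : Stage9Params F N) (D : FiniteEpsData F (SU N)) (g₀ : ℕ → ℝ)
  (os : List (ULoop F)) (p : B12.RunParams) (g : ℕ → ℝ) (k : ℕ)

/-- **★ THE PER-TOP-CUBE (M1) FROM THE IMAGE LAW OF A BLOCK CHART.**  dag-n21-d's ★★★ `cubeAC_of_slotAntiConcentration`
with the statistic `u := U ∘ Φ` for a measurable chart `Φ` of the level-`k` fields into a block frame `Y` and the (M1)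
binder MOVED to the image law `(cubeLawOfDatum₉ … t a).map Φ`: displayed — (H-U), `0 ≤ w`, `0 ≤ ρ`, F3's (e1)
integrability, the reading clauses (`U ∘ Φ` reads cube `a`'s two tests), `0 ≤ D`, (M1) on the image law.  Then
`Σ_s shellPiece … ρ t a s ≤ (D ρ)·Σ_s cubeWeight … t a s`. [textbook] -/
theorem cubeAC_of_chart (hU : LocalBgMeasurable F N ϑ.ν) (hw0 : ∀ k s' U V', 0 ≤ wOfRecord₉ F N ϑ p g k s' U V')
    {ρ : ℝ} (hρ : 0 ≤ ρ) (t : ℝ)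
    (a : ↥(cubeIndices (F.P p.K) (cubeSide (F.P p.K).L ϑ.ν.M₂ (RkOfRecord (F.P p.K).L ϑ.ν.r (g k)) k)))
    (hint : ∀ s : SeqOfRecord F ϑ.ν ϑ.τ9.M g p.K k,
      Integrable (fun V => chiSeqOfRecord F N ϑ.ν ϑ.τ9.M g p.K k s V * dressedSlotsOfDatum₉ F N ϑ D g₀ os t p g k s V)
        (fieldMeasure (F.P p.K) k (SU N)))
    {Y : Type*} [MeasurableSpace Y] {Φ : GaugeField (F.P p.K) k (SU N) → Y} (hΦ : Measurable Φ) (U : Y → ℝ)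
    (hu : ∀ V, U (Φ V) < epsOfRecord ϑ.ν g k ↔ cubeChiAt F N ϑ.ν g p.K k (epsOfRecord ϑ.ν g k) a V = 1)
    (hu' : ∀ V, U (Φ V) < epsOfRecord ϑ.ν g k * (1 - ρ) ↔
      cubeChiAt F N ϑ.ν g p.K k (epsOfRecord ϑ.ν g k * (1 - ρ)) a V = 1)
    {Dc : ℝ} (hD : 0 ≤ Dc)
    (hAC : SlotAntiConcentration ((cubeLawOfDatum₉ F N ϑ D g₀ os p g k t a).map Φ) U (epsOfRecord ϑ.ν g k) ρ Dc) :
    ∑ s, shellPieceOfDatum₉ F N ϑ D g₀ os p g k ρ t a s ≤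
      (Dc * ρ) * ∑ s, cubeWeightOfDatum₉ F N ϑ D g₀ os p g k t a s :=
  cubeAC_of_slotAntiConcentration F N ϑ D g₀ os p g k hU hw0 hρ t a hint (U ∘ Φ) hu hu' hD
    (slotAntiConcentration_comap hΦ hAC)

/-- **★★ THE PER-TOP-CUBE (M1) FROM A TWO-SIDED COMPARABLE FRAME LAW.**  The same with the (M1) binder on ANY frame
law `ν'` on `Y` that dominates the cube law's shell mass through the chart with ratio `M₁` (`hS`) and is dominated by it
in total mass with ratio `M₂` (`hmass`) — the chart need not be measurable.  Then
`Σ_s shellPiece ≤ (D·(M₁·M₂)·ρ)·Σ_s cubeWeight`. [textbook] -/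
theorem cubeAC_of_chart_dominated (hU : LocalBgMeasurable F N ϑ.ν)
    (hw0 : ∀ k s' U V', 0 ≤ wOfRecord₉ F N ϑ p g k s' U V') {ρ : ℝ} (hρ : 0 ≤ ρ) (t : ℝ)
    (a : ↥(cubeIndices (F.P p.K) (cubeSide (F.P p.K).L ϑ.ν.M₂ (RkOfRecord (F.P p.K).L ϑ.ν.r (g k)) k)))
    (hint : ∀ s : SeqOfRecord F ϑ.ν ϑ.τ9.M g p.K k,
      Integrable (fun V => chiSeqOfRecord F N ϑ.ν ϑ.τ9.M g p.K k s V * dressedSlotsOfDatum₉ F N ϑ D g₀ os t p g k s V)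
        (fieldMeasure (F.P p.K) k (SU N)))
    {Y : Type*} [MeasurableSpace Y] (Φ : GaugeField (F.P p.K) k (SU N) → Y) (U : Y → ℝ)
    (hu : ∀ V, U (Φ V) < epsOfRecord ϑ.ν g k ↔ cubeChiAt F N ϑ.ν g p.K k (epsOfRecord ϑ.ν g k) a V = 1)
    (hu' : ∀ V, U (Φ V) < epsOfRecord ϑ.ν g k * (1 - ρ) ↔
      cubeChiAt F N ϑ.ν g p.K k (epsOfRecord ϑ.ν g k * (1 - ρ)) a V = 1)
    (ν' : Measure Y) {Dc M₁ M₂ : ℝ} (hD : 0 ≤ Dc) (hM₁ : 0 ≤ M₁) (hM₂ : 0 ≤ M₂)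
    (hS : cubeLawOfDatum₉ F N ϑ D g₀ os p g k t a
        {V | epsOfRecord ϑ.ν g k * (1 - ρ) ≤ U (Φ V) ∧ U (Φ V) < epsOfRecord ϑ.ν g k} ≤
      ENNReal.ofReal M₁ * ν' {y | epsOfRecord ϑ.ν g k * (1 - ρ) ≤ U y ∧ U y < epsOfRecord ϑ.ν g k})
    (hmass : ν' univ ≤ ENNReal.ofReal M₂ * cubeLawOfDatum₉ F N ϑ D g₀ os p g k t a univ)
    (hAC : SlotAntiConcentration ν' U (epsOfRecord ϑ.ν g k) ρ Dc) :
    ∑ s, shellPieceOfDatum₉ F N ϑ D g₀ os p g k ρ t a s ≤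
      (Dc * (M₁ * M₂) * ρ) * ∑ s, cubeWeightOfDatum₉ F N ϑ D g₀ os p g k t a s :=
  cubeAC_of_slotAntiConcentration F N ϑ D g₀ os p g k hU hw0 hρ t a hint (U ∘ Φ) hu hu'
    (mul_nonneg hD (mul_nonneg hM₁ hM₂)) (slotAntiConcentration_of_chartLaw_dominated Φ hD hρ hM₁ hS hAC hmass)

/-- **★★′ THE PER-TOP-CUBE (M1) FROM AN EXACT DISINTEGRATION WITH COMPARABLE DENSITIES.**  The dictionary as NODE O
would meet it: a measurable chart `Φ`, the image law IS `(base.withDensity d₁)|E` (the (2.18) fibre law's density `d₁`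
in block coordinates on the kept event `E`), a model density `d₀` two-sided comparable to `d₁` on `E` (ratios `M₁`,
`M₂`), `U` measurable, and (M1) for the MODEL law `(base.withDensity d₀)|E`.  Then
`Σ_s shellPiece ≤ (D·(M₁·M₂)·ρ)·Σ_s cubeWeight` (★★ with `hS ∕ hmass` produced by §1 `withDensity_restrict_le_of_le`).
[textbook] -/
theorem cubeAC_of_chart_comparableDensity (hU : LocalBgMeasurable F N ϑ.ν)
    (hw0 : ∀ k s' U V', 0 ≤ wOfRecord₉ F N ϑ p g k s' U V') {ρ : ℝ} (hρ : 0 ≤ ρ) (t : ℝ)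
    (a : ↥(cubeIndices (F.P p.K) (cubeSide (F.P p.K).L ϑ.ν.M₂ (RkOfRecord (F.P p.K).L ϑ.ν.r (g k)) k)))
    (hint : ∀ s : SeqOfRecord F ϑ.ν ϑ.τ9.M g p.K k,
      Integrable (fun V => chiSeqOfRecord F N ϑ.ν ϑ.τ9.M g p.K k s V * dressedSlotsOfDatum₉ F N ϑ D g₀ os t p g k s V)
        (fieldMeasure (F.P p.K) k (SU N)))
    {Y : Type*} [MeasurableSpace Y] {Φ : GaugeField (F.P p.K) k (SU N) → Y} (hΦ : Measurable Φ) {U : Y → ℝ}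
    (hUm : Measurable U)
    (hu : ∀ V, U (Φ V) < epsOfRecord ϑ.ν g k ↔ cubeChiAt F N ϑ.ν g p.K k (epsOfRecord ϑ.ν g k) a V = 1)
    (hu' : ∀ V, U (Φ V) < epsOfRecord ϑ.ν g k * (1 - ρ) ↔
      cubeChiAt F N ϑ.ν g p.K k (epsOfRecord ϑ.ν g k * (1 - ρ)) a V = 1)
    (base : Measure Y) (d₁ d₀ : Y → ℝ≥0∞) {E : Set Y} (hE : MeasurableSet E)
    (hdict : (cubeLawOfDatum₉ F N ϑ D g₀ os p g k t a).map Φ = (base.withDensity d₁).restrict E)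
    {Dc M₁ M₂ : ℝ} (hD : 0 ≤ Dc) (hM₁ : 0 ≤ M₁) (hM₂ : 0 ≤ M₂)
    (hd₁ : ∀ y ∈ E, d₁ y ≤ ENNReal.ofReal M₁ * d₀ y) (hd₀ : ∀ y ∈ E, d₀ y ≤ ENNReal.ofReal M₂ * d₁ y)
    (hAC : SlotAntiConcentration ((base.withDensity d₀).restrict E) U (epsOfRecord ϑ.ν g k) ρ Dc) :
    ∑ s, shellPieceOfDatum₉ F N ϑ D g₀ os p g k ρ t a s ≤
      (Dc * (M₁ * M₂) * ρ) * ∑ s, cubeWeightOfDatum₉ F N ϑ D g₀ os p g k t a s := by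
  have hSm : MeasurableSet {y | epsOfRecord ϑ.ν g k * (1 - ρ) ≤ U y ∧ U y < epsOfRecord ϑ.ν g k} :=
    (measurableSet_le measurable_const hUm).inter (measurableSet_lt hUm measurable_const)
  refine cubeAC_of_chart_dominated F N ϑ D g₀ os p g k hU hw0 hρ t a hint Φ U hu hu' ((base.withDensity d₀).restrict E)
    hD hM₁ hM₂ ?_ ?_ hAC
  · calc cubeLawOfDatum₉ F N ϑ D g₀ os p g k t a
          {V | epsOfRecord ϑ.ν g k * (1 - ρ) ≤ U (Φ V) ∧ U (Φ V) < epsOfRecord ϑ.ν g k}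
        ≤ (cubeLawOfDatum₉ F N ϑ D g₀ os p g k t a).map Φ
            {y | epsOfRecord ϑ.ν g k * (1 - ρ) ≤ U y ∧ U y < epsOfRecord ϑ.ν g k} :=
          Measure.le_map_apply hΦ.aemeasurable _
      _ ≤ ENNReal.ofReal M₁ * (base.withDensity d₀).restrict E
            {y | epsOfRecord ϑ.ν g k * (1 - ρ) ≤ U y ∧ U y < epsOfRecord ϑ.ν g k} := by
          rw [hdict]; exact withDensity_restrict_le_of_le hE hSm hd₁
  · calc (base.withDensity d₀).restrict E univ ≤ ENNReal.ofReal M₂ * (base.withDensity d₁).restrict E univ :=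
          withDensity_restrict_le_of_le hE MeasurableSet.univ hd₀
      _ = ENNReal.ofReal M₂ * cubeLawOfDatum₉ F N ϑ D g₀ os p g k t a univ := by
          rw [← hdict, Measure.map_apply hΦ MeasurableSet.univ, Set.preimage_univ]

variable {X : Type*} [MeasurableSpace X] {κ : Type*} [Fintype κ] [DecidableEq κ]

/-- **★★★ THE LOW-CENTRE COLLAR END AT THE CUBE LAW.**  Frame of 38m ★★★
`N21CollarJunctionLowCentre.slotAntiConcentration_restrict_of_lowCentre_letterwise` (exterior law `ζ`, block
`κ → ℝ`, density `𝟙_{K p.1}(p.2)·e^{−φ_{p.1}(p.2)}` with convex kept cuts and a convex block potential, a measurable LOW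
centre `m`, cut event `C⋆ ∩ ⋂ᵢ{q.2 i ∈ P₁ i}`, `U ∕ C⋆` reading no collar coordinate, per-coordinate odds `Qᵢ`, radial
transversality `κ₀`, letters, core) at threshold `θ := ε_k` and width `ρ ∈ (0,1)`; a block chart `Φ` of the level-`k`
fields into the frame reading cube `a`'s two tests through `U`, and the two-sided domination dictionary (`hS` ratio
`M₁`, `hmass` ratio `M₂`) between the cube law and the frame law `ν|({U<ε_k} ∩ C)`.  Then dag-n21-d's per-top-cube (M1)
holds AT cube `a`: `Σ_s shellPiece … ρ t a s ≤ ((3(#κ+1)∏ᵢ(1+Qᵢ)∕(κ₀(1−ρ)))·(M₁·M₂)·ρ)·Σ_s cubeWeight … t a s`.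
[textbook] -/
theorem cubeAC_of_lowCentre_collar_chart (hU : LocalBgMeasurable F N ϑ.ν)
    (hw0 : ∀ k s' U V', 0 ≤ wOfRecord₉ F N ϑ p g k s' U V') (t : ℝ)
    (a : ↥(cubeIndices (F.P p.K) (cubeSide (F.P p.K).L ϑ.ν.M₂ (RkOfRecord (F.P p.K).L ϑ.ν.r (g k)) k)))
    (hint : ∀ s : SeqOfRecord F ϑ.ν ϑ.τ9.M g p.K k,
      Integrable (fun V => chiSeqOfRecord F N ϑ.ν ϑ.τ9.M g p.K k s V * dressedSlotsOfDatum₉ F N ϑ D g₀ os t p g k s V)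
        (fieldMeasure (F.P p.K) k (SU N)))
    -- the frame (38m ★★★'s data and binders, `θ := ε_k`)
    [Nonempty κ] (ζ : Measure X) [SFinite ζ]
    {m : X → (κ → ℝ)} (hm : Measurable m) (K : X → Set (κ → ℝ)) (φ : X → (κ → ℝ) → ℝ)
    (hg : Measurable fun q : X × (κ → ℝ) =>
      (K q.1).indicator (fun w => ENNReal.ofReal (Real.exp (-φ q.1 w))) q.2)
    [IsFiniteMeasure ((ζ.prod volume).withDensity fun q : X × (κ → ℝ) =>
      (K q.1).indicator (fun w => ENNReal.ofReal (Real.exp (-φ q.1 w))) q.2)]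
    {U : X × (κ → ℝ) → ℝ} (hUm : Measurable U)
    {Cstar : Set (X × (κ → ℝ))} (hCstar : MeasurableSet Cstar)
    (Mc : Finset κ) (P₁ E₁ : κ → Set ℝ) (hP₁ : ∀ i ∈ Mc, MeasurableSet (P₁ i))
    (hE₁ : ∀ i ∈ Mc, MeasurableSet (E₁ i)) (hPE : ∀ i ∈ Mc, P₁ i ⊆ E₁ i) (Q : κ → ℝ) (hQ0 : ∀ i ∈ Mc, 0 ≤ Q i)
    (hodds : ∀ i ∈ Mc, ∀ C : Set (X × (κ → ℝ)), MeasurableSet C →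
      (∀ (z : X) (w : κ → ℝ) (y : ℝ), (z, update w i y) ∈ C ↔ (z, w) ∈ C) →
      ((ζ.prod volume).withDensity fun q : X × (κ → ℝ) =>
          (K q.1).indicator (fun w => ENNReal.ofReal (Real.exp (-φ q.1 w))) q.2)
          (({q | q.2 i ∈ E₁ i} \ {q | q.2 i ∈ P₁ i}) ∩ C)
        ≤ ENNReal.ofReal (Q i) *
          ((ζ.prod volume).withDensity fun q : X × (κ → ℝ) =>
            (K q.1).indicator (fun w => ENNReal.ofReal (Real.exp (-φ q.1 w))) q.2) ({q | q.2 i ∈ P₁ i} ∩ C))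
    (hUi : ∀ i ∈ Mc, ∀ (z : X) (w : κ → ℝ) (y : ℝ), U (z, update w i y) = U (z, w))
    (hCi : ∀ i ∈ Mc, ∀ (z : X) (w : κ → ℝ) (y : ℝ), (z, update w i y) ∈ Cstar ↔ (z, w) ∈ Cstar)
    {ρ κ₀ : ℝ} (hε : 0 < epsOfRecord ϑ.ν g k) (hρ0 : 0 < ρ) (hρ1 : ρ < 1) (hκ : 0 < κ₀)
    (hK : ∀ z, Convex ℝ (K z)) (hφ : ∀ z, ConvexOn ℝ (K z) (φ z)) (hmK : ∀ z, m z ∈ K z)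
    (hlow : ∀ q : X × (κ → ℝ), epsOfRecord ϑ.ν g k * (1 - ρ) ≤ U q → U q < epsOfRecord ϑ.ν g k →
      q ∈ Cstar ∩ ⋂ i ∈ Mc, {q : X × (κ → ℝ) | q.2 i ∈ P₁ i} → q.2 ∈ K q.1 →
        φ q.1 (m q.1) ≤ φ q.1 (m q.1 + (1 - 1 / ((Fintype.card κ : ℝ) + 1)) • (q.2 - m q.1)))
    (hletter : ∀ i ∈ Mc, ∀ l ∈ Icc (1 - 1 / ((Fintype.card κ : ℝ) + 1)) 1, ∀ (z : X) (w : κ → ℝ),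
      w i ∈ P₁ i → (m z + l • (w - m z)) i ∈ E₁ i)
    (hcore : ∀ l ∈ Icc (1 - 1 / ((Fintype.card κ : ℝ) + 1)) 1, ∀ q : X × (κ → ℝ),
      epsOfRecord ϑ.ν g k * (1 - ρ) ≤ U q → U q < epsOfRecord ϑ.ν g k → q ∈ Cstar →
        (q.1, m q.1 + l • (q.2 - m q.1)) ∈ {q : X × (κ → ℝ) | U q < epsOfRecord ϑ.ν g k} ∩ Cstar)
    (hRT : ∀ q : X × (κ → ℝ), epsOfRecord ϑ.ν g k * (1 - ρ) ≤ U q → U q < epsOfRecord ϑ.ν g k →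
      q ∈ Cstar ∩ ⋂ i ∈ Mc, {q : X × (κ → ℝ) | q.2 i ∈ P₁ i} → ∀ s : ℝ, 1 ≤ s →
      epsOfRecord ϑ.ν g k * (1 - ρ) ≤ U (q.1, m q.1 + s • (q.2 - m q.1)) →
        U (q.1, m q.1 + s • (q.2 - m q.1)) < epsOfRecord ϑ.ν g k →
        (q.1, m q.1 + s • (q.2 - m q.1)) ∈ Cstar ∩ ⋂ i ∈ Mc, {q : X × (κ → ℝ) | q.2 i ∈ P₁ i} →
          U q + κ₀ * (epsOfRecord ϑ.ν g k * (1 - ρ)) * (s - 1) ≤ U (q.1, m q.1 + s • (q.2 - m q.1)))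
    -- the block chart and its dictionary
    (Φ : GaugeField (F.P p.K) k (SU N) → X × (κ → ℝ))
    (hu : ∀ V, U (Φ V) < epsOfRecord ϑ.ν g k ↔ cubeChiAt F N ϑ.ν g p.K k (epsOfRecord ϑ.ν g k) a V = 1)
    (hu' : ∀ V, U (Φ V) < epsOfRecord ϑ.ν g k * (1 - ρ) ↔
      cubeChiAt F N ϑ.ν g p.K k (epsOfRecord ϑ.ν g k * (1 - ρ)) a V = 1)
    {M₁ M₂ : ℝ} (hM₁ : 0 ≤ M₁) (hM₂ : 0 ≤ M₂)
    (hS : cubeLawOfDatum₉ F N ϑ D g₀ os p g k t a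
        {V | epsOfRecord ϑ.ν g k * (1 - ρ) ≤ U (Φ V) ∧ U (Φ V) < epsOfRecord ϑ.ν g k} ≤
      ENNReal.ofReal M₁ * (((ζ.prod volume).withDensity fun q : X × (κ → ℝ) =>
          (K q.1).indicator (fun w => ENNReal.ofReal (Real.exp (-φ q.1 w))) q.2).restrict
        ({q | U q < epsOfRecord ϑ.ν g k} ∩ (Cstar ∩ ⋂ i ∈ Mc, {q : X × (κ → ℝ) | q.2 i ∈ P₁ i})))
        {y | epsOfRecord ϑ.ν g k * (1 - ρ) ≤ U y ∧ U y < epsOfRecord ϑ.ν g k})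
    (hmass : (((ζ.prod volume).withDensity fun q : X × (κ → ℝ) =>
          (K q.1).indicator (fun w => ENNReal.ofReal (Real.exp (-φ q.1 w))) q.2).restrict
        ({q | U q < epsOfRecord ϑ.ν g k} ∩ (Cstar ∩ ⋂ i ∈ Mc, {q : X × (κ → ℝ) | q.2 i ∈ P₁ i}))) univ ≤
      ENNReal.ofReal M₂ * cubeLawOfDatum₉ F N ϑ D g₀ os p g k t a univ) :
    ∑ s, shellPieceOfDatum₉ F N ϑ D g₀ os p g k ρ t a s ≤
      ((3 * ((Fintype.card κ : ℝ) + 1) * (∏ i ∈ Mc, (1 + Q i)) / (κ₀ * (1 - ρ))) * (M₁ * M₂) * ρ) *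
        ∑ s, cubeWeightOfDatum₉ F N ϑ D g₀ os p g k t a s := by
  have hD : 0 ≤ 3 * ((Fintype.card κ : ℝ) + 1) * (∏ i ∈ Mc, (1 + Q i)) / (κ₀ * (1 - ρ)) :=
    div_nonneg (mul_nonneg (by positivity) (Finset.prod_nonneg fun i hi => by linarith [hQ0 i hi]))
      (mul_nonneg hκ.le (by linarith))
  exact cubeAC_of_chart_dominated F N ϑ D g₀ os p g k hU hw0 hρ0.le t a hint Φ U hu hu' _ hD hM₁ hM₂ hS hmass
    (slotAntiConcentration_restrict_of_lowCentre_letterwise ζ hm K φ hg hUm hCstar Mc P₁ E₁ hP₁ hE₁ hPE Q hQ0 hodds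
      hUi hCi hε hρ0 hρ1 hκ hK hφ hmK hlow hletter hcore hRT)

/-- **★★★ THE PROJECTED-CENTRE COLLAR END AT THE CUBE LAW.**  The same with 38n ★★★
`N21CollarJunctionProjectedCentre.slotAntiConcentration_restrict_of_projectedCentre_letterwise` (density
`𝟙_{K p.1}(p.2)·exp(−(½⟨p.2 − m p.1, A(p.2 − m p.1)⟩ + P p.1 p.2))`, `A` symmetric `γ`-coercive, `P z` `G`-Lipschitz on the
convex kept cut, dilation centre `c z ∈ K z`, obtuse cross terms `hobt` and `2G∕γ`-farness `hfar` at the shell ∩ cut).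
[textbook] -/
theorem cubeAC_of_projectedCentre_collar_chart (hU : LocalBgMeasurable F N ϑ.ν)
    (hw0 : ∀ k s' U V', 0 ≤ wOfRecord₉ F N ϑ p g k s' U V') (t : ℝ)
    (a : ↥(cubeIndices (F.P p.K) (cubeSide (F.P p.K).L ϑ.ν.M₂ (RkOfRecord (F.P p.K).L ϑ.ν.r (g k)) k)))
    (hint : ∀ s : SeqOfRecord F ϑ.ν ϑ.τ9.M g p.K k,
      Integrable (fun V => chiSeqOfRecord F N ϑ.ν ϑ.τ9.M g p.K k s V * dressedSlotsOfDatum₉ F N ϑ D g₀ os t p g k s V)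
        (fieldMeasure (F.P p.K) k (SU N)))
    -- the frame (38n ★★★'s data and binders, `θ := ε_k`)
    [Nonempty κ] (ζ : Measure X) [SFinite ζ]
    (K : X → Set (κ → ℝ)) (A : Matrix κ κ ℝ) (hA : A.IsSymm) {γ G : ℝ} (hγ0 : 0 < γ)
    (hγ : ∀ x : κ → ℝ, γ * ‖x‖ ^ 2 ≤ x ⬝ᵥ (A *ᵥ x))
    (m : X → (κ → ℝ)) {c : X → (κ → ℝ)} (hc : Measurable c) (P : X → (κ → ℝ) → ℝ)
    (hg : Measurable fun q : X × (κ → ℝ) => (K q.1).indicator (fun w => ENNReal.ofReal (Real.exp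
      (-(1 / 2 * ((w - m q.1) ⬝ᵥ (A *ᵥ (w - m q.1))) + P q.1 w)))) q.2)
    [IsFiniteMeasure ((ζ.prod volume).withDensity fun q : X × (κ → ℝ) => (K q.1).indicator (fun w =>
      ENNReal.ofReal (Real.exp (-(1 / 2 * ((w - m q.1) ⬝ᵥ (A *ᵥ (w - m q.1))) + P q.1 w)))) q.2)]
    {U : X × (κ → ℝ) → ℝ} (hUm : Measurable U)
    {Cstar : Set (X × (κ → ℝ))} (hCstar : MeasurableSet Cstar)
    (Mc : Finset κ) (P₁ E₁ : κ → Set ℝ) (hP₁ : ∀ i ∈ Mc, MeasurableSet (P₁ i))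
    (hE₁ : ∀ i ∈ Mc, MeasurableSet (E₁ i)) (hPE : ∀ i ∈ Mc, P₁ i ⊆ E₁ i) (Q : κ → ℝ) (hQ0 : ∀ i ∈ Mc, 0 ≤ Q i)
    (hodds : ∀ i ∈ Mc, ∀ C : Set (X × (κ → ℝ)), MeasurableSet C →
      (∀ (z : X) (w : κ → ℝ) (y : ℝ), (z, update w i y) ∈ C ↔ (z, w) ∈ C) →
      ((ζ.prod volume).withDensity fun q : X × (κ → ℝ) => (K q.1).indicator (fun w => ENNReal.ofReal (Real.exp
          (-(1 / 2 * ((w - m q.1) ⬝ᵥ (A *ᵥ (w - m q.1))) + P q.1 w)))) q.2)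
          (({q | q.2 i ∈ E₁ i} \ {q | q.2 i ∈ P₁ i}) ∩ C)
        ≤ ENNReal.ofReal (Q i) *
          ((ζ.prod volume).withDensity fun q : X × (κ → ℝ) => (K q.1).indicator (fun w => ENNReal.ofReal (Real.exp
            (-(1 / 2 * ((w - m q.1) ⬝ᵥ (A *ᵥ (w - m q.1))) + P q.1 w)))) q.2) ({q | q.2 i ∈ P₁ i} ∩ C))
    (hUi : ∀ i ∈ Mc, ∀ (z : X) (w : κ → ℝ) (y : ℝ), U (z, update w i y) = U (z, w))
    (hCi : ∀ i ∈ Mc, ∀ (z : X) (w : κ → ℝ) (y : ℝ), (z, update w i y) ∈ Cstar ↔ (z, w) ∈ Cstar)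
    {ρ κ₀ : ℝ} (hε : 0 < epsOfRecord ϑ.ν g k) (hρ0 : 0 < ρ) (hρ1 : ρ < 1) (hκ : 0 < κ₀)
    (hK : ∀ z, Convex ℝ (K z)) (hcK : ∀ z, c z ∈ K z)
    (hP : ∀ z, ∀ v ∈ K z, ∀ v' ∈ K z, P z v - P z v' ≤ G * ‖v - v'‖)
    (hobt : ∀ q : X × (κ → ℝ), epsOfRecord ϑ.ν g k * (1 - ρ) ≤ U q → U q < epsOfRecord ϑ.ν g k →
      q ∈ Cstar ∩ ⋂ i ∈ Mc, {q : X × (κ → ℝ) | q.2 i ∈ P₁ i} → q.2 ∈ K q.1 →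
        0 ≤ (c q.1 - m q.1) ⬝ᵥ (A *ᵥ (q.2 - c q.1)))
    (hfar : ∀ q : X × (κ → ℝ), epsOfRecord ϑ.ν g k * (1 - ρ) ≤ U q → U q < epsOfRecord ϑ.ν g k →
      q ∈ Cstar ∩ ⋂ i ∈ Mc, {q : X × (κ → ℝ) | q.2 i ∈ P₁ i} → q.2 ∈ K q.1 → 2 * G ≤ γ * ‖q.2 - c q.1‖)
    (hletter : ∀ i ∈ Mc, ∀ l ∈ Icc (1 - 1 / ((Fintype.card κ : ℝ) + 1)) 1, ∀ (z : X) (w : κ → ℝ),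
      w i ∈ P₁ i → (c z + l • (w - c z)) i ∈ E₁ i)
    (hcore : ∀ l ∈ Icc (1 - 1 / ((Fintype.card κ : ℝ) + 1)) 1, ∀ q : X × (κ → ℝ),
      epsOfRecord ϑ.ν g k * (1 - ρ) ≤ U q → U q < epsOfRecord ϑ.ν g k → q ∈ Cstar →
        (q.1, c q.1 + l • (q.2 - c q.1)) ∈ {q : X × (κ → ℝ) | U q < epsOfRecord ϑ.ν g k} ∩ Cstar)
    (hRT : ∀ q : X × (κ → ℝ), epsOfRecord ϑ.ν g k * (1 - ρ) ≤ U q → U q < epsOfRecord ϑ.ν g k →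
      q ∈ Cstar ∩ ⋂ i ∈ Mc, {q : X × (κ → ℝ) | q.2 i ∈ P₁ i} → ∀ s : ℝ, 1 ≤ s →
      epsOfRecord ϑ.ν g k * (1 - ρ) ≤ U (q.1, c q.1 + s • (q.2 - c q.1)) →
        U (q.1, c q.1 + s • (q.2 - c q.1)) < epsOfRecord ϑ.ν g k →
        (q.1, c q.1 + s • (q.2 - c q.1)) ∈ Cstar ∩ ⋂ i ∈ Mc, {q : X × (κ → ℝ) | q.2 i ∈ P₁ i} →
          U q + κ₀ * (epsOfRecord ϑ.ν g k * (1 - ρ)) * (s - 1) ≤ U (q.1, c q.1 + s • (q.2 - c q.1)))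
    -- the block chart and its dictionary
    (Φ : GaugeField (F.P p.K) k (SU N) → X × (κ → ℝ))
    (hu : ∀ V, U (Φ V) < epsOfRecord ϑ.ν g k ↔ cubeChiAt F N ϑ.ν g p.K k (epsOfRecord ϑ.ν g k) a V = 1)
    (hu' : ∀ V, U (Φ V) < epsOfRecord ϑ.ν g k * (1 - ρ) ↔
      cubeChiAt F N ϑ.ν g p.K k (epsOfRecord ϑ.ν g k * (1 - ρ)) a V = 1)
    {M₁ M₂ : ℝ} (hM₁ : 0 ≤ M₁) (hM₂ : 0 ≤ M₂)
    (hS : cubeLawOfDatum₉ F N ϑ D g₀ os p g k t a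
        {V | epsOfRecord ϑ.ν g k * (1 - ρ) ≤ U (Φ V) ∧ U (Φ V) < epsOfRecord ϑ.ν g k} ≤
      ENNReal.ofReal M₁ * (((ζ.prod volume).withDensity fun q : X × (κ → ℝ) => (K q.1).indicator (fun w =>
          ENNReal.ofReal (Real.exp (-(1 / 2 * ((w - m q.1) ⬝ᵥ (A *ᵥ (w - m q.1))) + P q.1 w)))) q.2).restrict
        ({q | U q < epsOfRecord ϑ.ν g k} ∩ (Cstar ∩ ⋂ i ∈ Mc, {q : X × (κ → ℝ) | q.2 i ∈ P₁ i})))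
        {y | epsOfRecord ϑ.ν g k * (1 - ρ) ≤ U y ∧ U y < epsOfRecord ϑ.ν g k})
    (hmass : (((ζ.prod volume).withDensity fun q : X × (κ → ℝ) => (K q.1).indicator (fun w => ENNReal.ofReal
        (Real.exp (-(1 / 2 * ((w - m q.1) ⬝ᵥ (A *ᵥ (w - m q.1))) + P q.1 w)))) q.2).restrict
        ({q | U q < epsOfRecord ϑ.ν g k} ∩ (Cstar ∩ ⋂ i ∈ Mc, {q : X × (κ → ℝ) | q.2 i ∈ P₁ i}))) univ ≤
      ENNReal.ofReal M₂ * cubeLawOfDatum₉ F N ϑ D g₀ os p g k t a univ) :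
    ∑ s, shellPieceOfDatum₉ F N ϑ D g₀ os p g k ρ t a s ≤
      ((3 * ((Fintype.card κ : ℝ) + 1) * (∏ i ∈ Mc, (1 + Q i)) / (κ₀ * (1 - ρ))) * (M₁ * M₂) * ρ) *
        ∑ s, cubeWeightOfDatum₉ F N ϑ D g₀ os p g k t a s := by
  have hD : 0 ≤ 3 * ((Fintype.card κ : ℝ) + 1) * (∏ i ∈ Mc, (1 + Q i)) / (κ₀ * (1 - ρ)) :=
    div_nonneg (mul_nonneg (by positivity) (Finset.prod_nonneg fun i hi => by linarith [hQ0 i hi]))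
      (mul_nonneg hκ.le (by linarith))
  exact cubeAC_of_chart_dominated F N ϑ D g₀ os p g k hU hw0 hρ0.le t a hint Φ U hu hu' _ hD hM₁ hM₂ hS hmass
    (slotAntiConcentration_restrict_of_projectedCentre_letterwise ζ K A hA hγ0 hγ m hc P hg hUm hCstar Mc P₁ E₁ hP₁
      hE₁ hPE Q hQ0 hodds hUi hCi hε hρ0 hρ1 hκ hK hcK hP hobt hfar hletter hcore hRT)

end AtCubeLaw

end Summit.QuantumFields.YangMills.Theorems.N21CollarJunctionAtCubeLaw
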